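import Mathlib
import Summits.CriticalPhenomena.PercolationContinuityZ3.Theorems.PercNearOneGluingNoHeavyLowerTailHexMSMatchReservedTerms

/-!
# Two-type block order with reserved terms; designated sets with new second differences are free (hp-7 gen 78)

Support file for crux `stmt-CriticalPhenomena-4575` (route `PercNearOneGluingNoHeavy`), hull-port seat `prim-hp-7` (generation 78);
`--supports stmt-CriticalPhenomena-4575`.  No `sorry`.  Memo: `run/shared/lean/prim/prim-hp-7/FROM-prim-hp-7-g78-RECTANGLES-AND-REDUCTIONS.md` §0.

Gen 76's `ReservedTerms.card_add_card_le_card_diffs_of_blockOrder` is the ONE-TYPE block order (type-5 designated sets only, reserved as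
themselves, block `Q` peeled before block `P`).  This file gives the TWO-TYPE version: the blocks are ranked `P` before `Q` (inside a block by
decreasing cardinality) and an ARBITRARY reserved family `Θ` is allowed as long as it avoids the forward differences of that rank — all `p \ q`,
and the same-block differences `f \ g` with `#g ≤ #f`.

* `BlockReserved.ms2_of_blockOrder` — (MS2) for an instance `(P, Q, D₅, D₂)` from an injective reservation `τ` (values nonempty terms) avoiding
  those forward differences; this is `ReservedTerms.ms2_of_orderCert` with the block rank made explicit, so that the hypotheses are finitary
  avoidance conditions on `τ` (no rank function to supply).
* `BlockReserved.ms2_of_blockOrder_new` — the structural special case ('new second differences are free'): `P` before `Q`, every type-2 set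
  `d ∈ D₂ ⊆ Q \\ P` reserved as itself (legal as soon as it is pure and not of the form `p \ q`, which the depth-one constraint `d ⊄ p` gives),
  every type-5 set `d ∈ D₅` re-reserved to a NEW second difference `σ d ∈ P \\ D₅` that is not a difference of two members, `σ` injective on
  `D₅`; plus `p ⊄ q` across the blocks.  Then `#(F ∪ D₅ ∪ D₂) ≤ #(F \\ F ∪ P \\ D₅ ∪ Q \\ D₂)`.  (The mirror statement, `Q` before `P` with the
  types exchanged, is the same theorem applied to `(Q, P, D₂, D₅)`: `ms2_of_blockOrder_new'`.)  Numerically (memo §0): on the exhaustive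
  `2^[5]` census this 'newblock' leaf is the first applicable uniform theorem for 1 650 of 271 940 admissible instances, and together with
  tight-or-free, one-type and co-star plus the two monotone reductions (drop a designated set owning a private term; drop a member owning enough
  private terms) it settles every admissible instance on `2^[5]`.
-/

namespace Summit.CriticalPhenomena.PercolationContinuityZ3.Theorems

namespace BlockReserved

open Finset
open scoped FinsetFamily

variable {α : Type*} [DecidableEq α]

/-- **(MS2) under the two-type block order with reserved terms** (hp-7 gen 78).  Rank the members of `P` before those of `Q`, inside a
block by decreasing cardinality.  If `τ` is injective on `D₅ ∪ D₂` with nonempty values among the terms, no value `τ d` is a cross difference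
`p \ q`, no value is a same-block difference `f \ g` with `#g ≤ #f`, and no member of `P` is contained in a member of `Q`, then
`#((P ∪ Q) ∪ D₅ ∪ D₂) ≤ #((P ∪ Q) \\ (P ∪ Q) ∪ P \\ D₅ ∪ Q \\ D₂)`. -/
theorem ms2_of_blockOrder (P Q D₅ D₂ : Finset (Finset α)) (hPQ : Disjoint P Q)
    (hD₅ : D₅ ⊆ P \\ Q) (hD₂ : D₂ ⊆ Q \\ P) (τ : Finset α → Finset α)
    (hτT : ∀ d ∈ D₅ ∪ D₂, τ d ∈ ((P ∪ Q) \\ (P ∪ Q)) ∪ (P \\ D₅) ∪ (Q \\ D₂))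
    (hτ0 : ∀ d ∈ D₅ ∪ D₂, τ d ≠ ∅) (hτinj : Set.InjOn τ ↑(D₅ ∪ D₂))
    (hcont : ∀ p ∈ P, ∀ q ∈ Q, ¬ p ⊆ q)
    (hcross : ∀ d ∈ D₅ ∪ D₂, ∀ p ∈ P, ∀ q ∈ Q, τ d ≠ p \ q)
    (hP : ∀ d ∈ D₅ ∪ D₂, ∀ f ∈ P, ∀ g ∈ P, f ≠ g → #g ≤ #f → τ d ≠ f \ g)
    (hQ : ∀ d ∈ D₅ ∪ D₂, ∀ f ∈ Q, ∀ g ∈ Q, f ≠ g → #g ≤ #f → τ d ≠ f \ g) :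
    #((P ∪ Q) ∪ D₅ ∪ D₂) ≤ #(((P ∪ Q) \\ (P ∪ Q)) ∪ (P \\ D₅) ∪ (Q \\ D₂)) := by
  classical
  set F := P ∪ Q with hFdef
  -- the block rank: `P` first (rank `-#p ≤ 0`), then `Q` (rank `M + 1 - #q ≥ 1`)
  set M : ℕ := F.sup card with hM
  have hcardM : ∀ {f : Finset α}, f ∈ F → #f ≤ M := fun hf => le_sup (f := card) hf
  let r : Finset α → ℤ := fun f => (if f ∈ Q then (M : ℤ) + 1 else 0) - (#f : ℤ)
  have hPnotQ : ∀ {p : Finset α}, p ∈ P → p ∉ Q := fun hp hq => disjoint_left.mp hPQ hp hq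
  -- same-block pairs: larger first, so `f ⊄ g`
  have hblock : ∀ {f g : Finset α}, f ≠ g → #g ≤ #f → f \ g ≠ ∅ := by
    intro f g hne hle h0
    exact hne (eq_of_subset_of_card_le (sdiff_eq_empty_iff_subset.mp h0) hle)
  refine ReservedTerms.ms2_of_orderCert P Q D₅ D₂ hD₅ hD₂ r τ hτT hτ0 hτinj ?_
  intro f hf g hg hne hr
  rcases mem_union.mp hf with hfP | hfQ <;> rcases mem_union.mp hg with hgP | hgQ
  · -- `P`/`P`
    have hle : #g ≤ #f := by
      have : r f ≤ r g := hr
      simp only [r, if_neg (hPnotQ hfP), if_neg (hPnotQ hgP)] at this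
      omega
    exact ⟨hblock hne hle, fun d hd => hP d hd f hfP g hgP hne hle⟩
  · -- `P` before `Q`: `p \ q` is nonempty and never reserved
    exact ⟨fun h0 => hcont f hfP g hgQ (sdiff_eq_empty_iff_subset.mp h0), fun d hd => hcross d hd f hfP g hgQ⟩
  · -- `Q` before `P`: impossible along `r`
    exfalso
    have : r f ≤ r g := hr
    simp only [r, if_pos hfQ, if_neg (hPnotQ hgP)] at this
    have := hcardM hf
    omega
  · -- `Q`/`Q`
    have hle : #g ≤ #f := by
      have : r f ≤ r g := hr
      simp only [r, if_pos hfQ, if_pos hgQ] at this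
      omega
    exact ⟨hblock hne hle, fun d hd => hQ d hd f hfQ g hgQ hne hle⟩

/-- **Designated sets with new second differences are free** (hp-7 gen 78; the 'newblock' leaf of the reduction census).  Blocks `P` before
`Q`; the type-2 sets `D₂ ⊆ Q \\ P` are pure and not of the form `p \ q` (so, reserved as themselves, they are backward differences); each
type-5 set `d ∈ D₅` is re-reserved to a second difference `σ d ∈ P \\ D₅` which is NOT a difference of two members, `σ` injective on `D₅`;
and no member of `P` lies inside a member of `Q`.  Then (MS2) holds for `(P, Q, D₅, D₂)`. -/
theorem ms2_of_blockOrder_new (P Q D₅ D₂ : Finset (Finset α)) (hPQ : Disjoint P Q)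
    (hD₅ : D₅ ⊆ P \\ Q) (hD₂ : D₂ ⊆ Q \\ P)
    (hpure₂ : ∀ d ∈ D₂, d ∉ (P \\ P) ∪ (Q \\ Q)) (hrev₂ : ∀ d ∈ D₂, d ∉ P \\ Q)
    (hcont : ∀ p ∈ P, ∀ q ∈ Q, ¬ p ⊆ q)
    (σ : Finset α → Finset α) (hσ : ∀ d ∈ D₅, σ d ∈ P \\ D₅ ∧ σ d ∉ (P ∪ Q) \\ (P ∪ Q))
    (hσinj : Set.InjOn σ ↑D₅) :
    #((P ∪ Q) ∪ D₅ ∪ D₂) ≤ #(((P ∪ Q) \\ (P ∪ Q)) ∪ (P \\ D₅) ∪ (Q \\ D₂)) := by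
  classical
  set F := P ∪ Q with hFdef
  -- differences of members
  have hdiffP : ∀ {f g : Finset α}, f ∈ P → g ∈ P → f \ g ∈ F \\ F := fun hf hg =>
    mem_diffs.mpr ⟨_, mem_union_left _ hf, _, mem_union_left _ hg, rfl⟩
  have hdiffQ : ∀ {f g : Finset α}, f ∈ Q → g ∈ Q → f \ g ∈ F \\ F := fun hf hg =>
    mem_diffs.mpr ⟨_, mem_union_right _ hf, _, mem_union_right _ hg, rfl⟩
  have hdiffPQ : ∀ {p q : Finset α}, p ∈ P → q ∈ Q → p \ q ∈ F \\ F := fun hp hq =>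
    mem_diffs.mpr ⟨_, mem_union_left _ hp, _, mem_union_right _ hq, rfl⟩
  have hD₂F : ∀ {d : Finset α}, d ∈ D₂ → d ∈ F \\ F := by
    intro d hd
    obtain ⟨q, hq, p, hp, rfl⟩ := mem_diffs.mp (hD₂ hd)
    exact mem_diffs.mpr ⟨q, mem_union_right _ hq, p, mem_union_left _ hp, rfl⟩
  -- a type-5 value is never a type-2 set (the latter are differences)
  have hσD₂ : ∀ {d : Finset α}, d ∈ D₅ → σ d ∉ D₂ := fun hd h => (hσ _ hd).2 (hD₂F h)
  have hD₅D₂ : ∀ {d : Finset α}, d ∈ D₅ → d ∉ D₂ := by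
    intro d hd5 hd2
    exact hrev₂ d hd2 (hD₅ hd5)
  let τ : Finset α → Finset α := fun d => if d ∈ D₅ then σ d else d
  have hτ5 : ∀ {d : Finset α}, d ∈ D₅ → τ d = σ d := fun hd => by simp only [τ, if_pos hd]
  have hτ2 : ∀ {d : Finset α}, d ∈ D₂ → τ d = d := fun hd => by simp only [τ, if_neg (fun h => hD₅D₂ h hd)]
  refine ms2_of_blockOrder P Q D₅ D₂ hPQ hD₅ hD₂ τ ?_ ?_ ?_ hcont ?_ ?_ ?_
  · -- values are terms
    intro d hd
    rcases mem_union.mp hd with hd | hd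
    · rw [hτ5 hd]; exact mem_union_left _ (mem_union_right _ (hσ d hd).1)
    · rw [hτ2 hd]; exact mem_union_left _ (mem_union_left _ (hD₂F hd))
  · -- values are nonempty
    intro d hd h0
    rcases mem_union.mp hd with hd | hd
    · rw [hτ5 hd] at h0
      obtain ⟨p, hp, -, -, -⟩ := mem_diffs.mp (hD₅ hd)
      have h0F : (∅ : Finset α) ∈ F \\ F := mem_diffs.mpr ⟨p, mem_union_left _ hp, p, mem_union_left _ hp, (by simp : p \ p = ∅)⟩
      rw [← h0] at h0F
      exact (hσ d hd).2 h0F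
    · rw [hτ2 hd] at h0
      obtain ⟨q, hq, -, -, -⟩ := mem_diffs.mp (hD₂ hd)
      have h0Q : (∅ : Finset α) ∈ Q \\ Q := mem_diffs.mpr ⟨q, hq, q, hq, (by simp : q \ q = ∅)⟩
      rw [← h0] at h0Q
      exact hpure₂ d hd (mem_union_right _ h0Q)
  · -- injective
    intro d hd d' hd' h
    simp only [coe_union, Set.mem_union, mem_coe] at hd hd'
    rcases hd with hd | hd <;> rcases hd' with hd' | hd'
    · rw [hτ5 hd, hτ5 hd'] at h; exact hσinj hd hd' h
    · rw [hτ5 hd, hτ2 hd'] at h; exact absurd hd' (h ▸ hσD₂ hd)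
    · rw [hτ2 hd, hτ5 hd'] at h; exact absurd hd (h.symm ▸ hσD₂ hd')
    · rw [hτ2 hd, hτ2 hd'] at h; exact h
  · -- no value is a cross difference `p \ q`
    intro d hd p hp q hq h
    rcases mem_union.mp hd with hd | hd
    · rw [hτ5 hd] at h; exact (hσ d hd).2 (h ▸ hdiffPQ hp hq)
    · rw [hτ2 hd] at h; exact hrev₂ d hd (h ▸ mem_diffs.mpr ⟨p, hp, q, hq, rfl⟩)
  · -- no value is a `P`-`P` difference
    intro d hd f hf g hg _ _ h
    rcases mem_union.mp hd with hd | hd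
    · rw [hτ5 hd] at h; exact (hσ d hd).2 (h ▸ hdiffP hf hg)
    · rw [hτ2 hd] at h; exact hpure₂ d hd (mem_union_left _ (h ▸ mem_diffs.mpr ⟨f, hf, g, hg, rfl⟩))
  · -- no value is a `Q`-`Q` difference
    intro d hd f hf g hg _ _ h
    rcases mem_union.mp hd with hd | hd
    · rw [hτ5 hd] at h; exact (hσ d hd).2 (h ▸ hdiffQ hf hg)
    · rw [hτ2 hd] at h; exact hpure₂ d hd (mem_union_right _ (h ▸ mem_diffs.mpr ⟨f, hf, g, hg, rfl⟩))

/-- The mirror form of `ms2_of_blockOrder_new` (hp-7 gen 78): blocks `Q` before `P`, type-5 sets reserved as themselves (pure, not of the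
form `q \ p`), type-2 sets re-reserved to new second differences `σ d ∈ Q \\ D₂`, and no member of `Q` inside a member of `P`. -/
theorem ms2_of_blockOrder_new' (P Q D₅ D₂ : Finset (Finset α)) (hPQ : Disjoint P Q)
    (hD₅ : D₅ ⊆ P \\ Q) (hD₂ : D₂ ⊆ Q \\ P)
    (hpure₅ : ∀ d ∈ D₅, d ∉ (P \\ P) ∪ (Q \\ Q)) (hrev₅ : ∀ d ∈ D₅, d ∉ Q \\ P)
    (hcont : ∀ q ∈ Q, ∀ p ∈ P, ¬ q ⊆ p)
    (σ : Finset α → Finset α) (hσ : ∀ d ∈ D₂, σ d ∈ Q \\ D₂ ∧ σ d ∉ (P ∪ Q) \\ (P ∪ Q))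
    (hσinj : Set.InjOn σ ↑D₂) :
    #((P ∪ Q) ∪ D₅ ∪ D₂) ≤ #(((P ∪ Q) \\ (P ∪ Q)) ∪ (P \\ D₅) ∪ (Q \\ D₂)) := by
  classical
  have hpure₅' : ∀ d ∈ D₅, d ∉ (Q \\ Q) ∪ (P \\ P) := fun d hd h => by
    rcases mem_union.mp h with h | h
    · exact hpure₅ d hd (mem_union_right _ h)
    · exact hpure₅ d hd (mem_union_left _ h)
  have hσ' : ∀ d ∈ D₂, σ d ∈ Q \\ D₂ ∧ σ d ∉ (Q ∪ P) \\ (Q ∪ P) := fun d hd =>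
    ⟨(hσ d hd).1, by rw [union_comm Q P]; exact (hσ d hd).2⟩
  have h := ms2_of_blockOrder_new Q P D₂ D₅ hPQ.symm hD₂ hD₅ hpure₅' hrev₅ hcont σ hσ' hσinj
  have e1 : (Q ∪ P) ∪ D₂ ∪ D₅ = (P ∪ Q) ∪ D₅ ∪ D₂ := by
    rw [union_comm Q P, union_assoc, union_comm D₂ D₅, ← union_assoc]
  have e2 : ((Q ∪ P) \\ (Q ∪ P)) ∪ (Q \\ D₂) ∪ (P \\ D₅) = ((P ∪ Q) \\ (P ∪ Q)) ∪ (P \\ D₅) ∪ (Q \\ D₂) := by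
    rw [union_comm Q P, union_assoc, union_comm (Q \\ D₂) (P \\ D₅), ← union_assoc]
  rw [e1, e2] at h
  exact h

end BlockReserved

end Summit.CriticalPhenomena.PercolationContinuityZ3.Theorems
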